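import Literature.AlgebraicGeometry.Motives.EllAdicTowerFunctor
import Literature.AlgebraicGeometry.Motives.EtaleModCohomologyFrobenius
import HarnessLib

/-!
# The Galois representation on `lim_m H•((X_{k̄})_ét, ℤ/ℓᵐ)` and `F^* = ρ(F_geom)`

The `ℓ`-adic tower (`EllAdicTowerFunctor.lean`: `X ↦ lim_m H•(X_ét, ℤ/ℓᵐ)`, a functor to graded
`ℤ_ℓ`-algebras) of the geometric fibre `X_{k̄}` of a `k`-scheme `X` carries the Galois
representation `ρ(g) = (1 × Spec g)^*` (Deligne, Weil I (1.15), "par transport de structure"):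

* `geometricEllAdicTowerRep X ℓ n : Gal(k̄/k) →* End_{ℤ_ℓ}(lim_m Hⁿ((X_{k̄})_ét, ℤ/ℓᵐ))`, with
  components the level representations `geometricEtaleModCohomologyRep X (ℤ/ℓᵐ) n`
  (`EtaleModCohomologyFrobenius.lean`), multiplicative for the cup product (`_cup`) and
  commuting with pull-backs along `k`-morphisms (`_pullback`);
* over a finite field `k`: `etaleEllAdicTowerCohomologyMap_frobenius_eq_geomFrob`, **`F^* = ρ(F_geom)`**
  for the base-changed `k`-Frobenius `F = F_{X/k} × 1` (Deligne (1.15.1)), and the `q`-Frobenius of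
  `X_{k̄}` acts trivially; both componentwise from the level statements.

## References

* P. Deligne, *La conjecture de Weil. I*, Publ. Math. IHÉS 43 (1974), (1.15), (1.15.1). [Deligne1974]
* J. S. Milne, *Étale cohomology* (reissue 2025; held copy): VI §13 (p. 300). [Milne2025]
-/

universe u

open CategoryTheory CategoryTheory.Limits AlgebraicGeometry Opposite

namespace Literature.AlgebraicGeometry.Motives

section Galois

variable {k : Type u} [Field k] (X : SchemeOver k) (ℓ : ℕ) [Fact ℓ.Prime] (n : ℕ)

/-- **`lim_m Hⁿ((X_{k̄})_ét, ℤ/ℓᵐ)`**, the `ℓ`-adic tower cohomology of the geometric fibre (with its cup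
product and `ℤ_ℓ`-module structure). [folklore] -/
noncomputable abbrev geometricEllAdicTowerCohomology :
    AddSubgroup (∀ m, etaleZModPowCohomology (geometricFibre k X) ℓ m n) :=
  etaleEllAdicTowerCohomology (geometricFibre k X) ℓ n

/-- **The Galois representation on `lim_m Hⁿ((X_{k̄})_ét, ℤ/ℓᵐ)`**, `ρ(g) = (1 × Spec g)^*`, a
homomorphism `Gal(k̄/k) →* End_{ℤ_ℓ}` (right action of `Gal` on `X_{k̄}`, contravariance
`etaleEllAdicTowerCohomologyMap_comp/_id`). [cite: Deligne1974, (1.15)] -/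
noncomputable def geometricEllAdicTowerRep :
    Field.absoluteGaloisGroup k →* Module.End ℤ_[ℓ] (geometricEllAdicTowerCohomology X ℓ n) where
  toFun g := etaleEllAdicTowerCohomologyMap (geometricFibreMap X g) ℓ n
  map_one' := by
    apply LinearMap.ext
    intro x
    change etaleEllAdicTowerCohomologyMap (geometricFibreMap X 1) ℓ n x = x
    rw [geometricFibreMap_one]
    exact etaleEllAdicTowerCohomologyMap_id ℓ n x
  map_mul' g h := by
    apply LinearMap.ext
    intro x
    change etaleEllAdicTowerCohomologyMap (geometricFibreMap X (g * h)) ℓ n x =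
      etaleEllAdicTowerCohomologyMap (geometricFibreMap X g) ℓ n
        (etaleEllAdicTowerCohomologyMap (geometricFibreMap X h) ℓ n x)
    rw [geometricFibreMap_mul]
    exact etaleEllAdicTowerCohomologyMap_comp _ _ ℓ n x

/-- `ρ(g) = (1 × Spec g)^*` (by `rfl`). [folklore] -/
theorem geometricEllAdicTowerRep_apply (g : Field.absoluteGaloisGroup k)
    (x : geometricEllAdicTowerCohomology X ℓ n) :
    geometricEllAdicTowerRep X ℓ n g x = etaleEllAdicTowerCohomologyMap (geometricFibreMap X g) ℓ n x :=
  rfl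

/-- **Components of the `ℓ`-adic Galois representation** are the level representations on
`Hⁿ((X_{k̄})_ét, ℤ/ℓᵐ)`. [folklore] -/
theorem coe_geometricEllAdicTowerRep_apply (g : Field.absoluteGaloisGroup k)
    (x : geometricEllAdicTowerCohomology X ℓ n) (m : ℕ) :
    (geometricEllAdicTowerRep X ℓ n g x : ∀ m, etaleZModPowCohomology (geometricFibre k X) ℓ m n) m =
      geometricEtaleModCohomologyRep X (ZModPow.{u} ℓ m) n g
        ((x : ∀ m, etaleZModPowCohomology (geometricFibre k X) ℓ m n) m) :=
  rfl

/-- **The Galois action on the `ℓ`-adic tower is multiplicative**: `ρ(g)(x ∪ y) = ρ(g)x ∪ ρ(g)y`.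
[folklore] -/
theorem geometricEllAdicTowerRep_cup (g : Field.absoluteGaloisGroup k) {i j m : ℕ} (h : i + j = m)
    (x : geometricEllAdicTowerCohomology X ℓ i) (y : geometricEllAdicTowerCohomology X ℓ j) :
    geometricEllAdicTowerRep X ℓ m g (ellAdicTowerCohomology.cup h x y) =
      ellAdicTowerCohomology.cup h (geometricEllAdicTowerRep X ℓ i g x)
        (geometricEllAdicTowerRep X ℓ j g y) :=
  etaleEllAdicTowerCohomologyMap_cup _ ℓ h x y

/-- **The Galois action fixes the unit**: `ρ(g)(1) = 1`. [folklore] -/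
theorem geometricEllAdicTowerRep_one (g : Field.absoluteGaloisGroup k) :
    geometricEllAdicTowerRep X ℓ 0 g
        (ellAdicTowerCohomology.one (isTerminalEtaleMkId (geometricFibre k X)) ℓ) =
      ellAdicTowerCohomology.one (isTerminalEtaleMkId (geometricFibre k X)) ℓ :=
  etaleEllAdicTowerCohomologyMap_one _ ℓ

variable {X} in
/-- **Pull-backs along `k`-morphisms are Galois equivariant** on the `ℓ`-adic tower. [folklore] -/
theorem geometricEllAdicTowerRep_pullback {X' : SchemeOver k} (φ : X ⟶ X')
    (g : Field.absoluteGaloisGroup k) (y : geometricEllAdicTowerCohomology X' ℓ n) :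
    geometricEllAdicTowerRep X ℓ n g (etaleEllAdicTowerCohomologyMap (geometricFibreHom φ) ℓ n y) =
      etaleEllAdicTowerCohomologyMap (geometricFibreHom φ) ℓ n
        (geometricEllAdicTowerRep X' ℓ n g y) := by
  rw [geometricEllAdicTowerRep_apply, geometricEllAdicTowerRep_apply,
    ← etaleEllAdicTowerCohomologyMap_comp, ← etaleEllAdicTowerCohomologyMap_comp,
    geometricFibreMap_comp_geometricFibreHom]

variable [Finite k]

/-- **The `q`-Frobenius of `X_{k̄}` acts as the identity on `lim_m Hⁿ((X_{k̄})_ét, ℤ/ℓᵐ)`.**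
[cite: Milne2025, VI Lemma 13.2] -/
theorem etaleEllAdicTowerCohomologyMap_geometricFibreFrobenius
    (x : geometricEllAdicTowerCohomology X ℓ n) :
    etaleEllAdicTowerCohomologyMap (geometricFibreFrobenius X) ℓ n x = x :=
  Subtype.ext <| funext fun m =>
    etaleModCohomologyMap_geometricFibreFrobenius X (ZModPow.{u} ℓ m) n
      ((x : ∀ m, etaleZModPowCohomology (geometricFibre k X) ℓ m n) m)

/-- **`F^* = ρ(F_geom)` on `lim_m Hⁿ((X_{k̄})_ét, ℤ/ℓᵐ)`** for `F = F_{X/k} × 1` (Deligne, Weil I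
(1.15.1)), componentwise from `etaleModCohomologyMap_frobenius_eq_geomFrob`. [cite: Deligne1974, (1.15.1)] -/
theorem etaleEllAdicTowerCohomologyMap_frobenius_eq_geomFrob
    (x : geometricEllAdicTowerCohomology X ℓ n) :
    etaleEllAdicTowerCohomologyMap (geometricFibreHom (frobeniusOver X)) ℓ n x =
      geometricEllAdicTowerRep X ℓ n (geomFrob k) x :=
  Subtype.ext <| funext fun m =>
    etaleModCohomologyMap_frobenius_eq_geomFrob X (ZModPow.{u} ℓ m) n
      ((x : ∀ m, etaleZModPowCohomology (geometricFibre k X) ℓ m n) m)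

end Galois

end Literature.AlgebraicGeometry.Motives
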